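import Mathlib
import Summits.Ventures.PercRepro2.K5Kernel
import Summits.Ventures.PercRepro2.K5Kron
import Summits.Ventures.PercRepro2.K5Digits
import Summits.Ventures.PercRepro2.K5Theorem
import Summits.Ventures.PercRepro2.PMK5Kernel
import Summits.Ventures.PercRepro2.PMK5Bridge
import Summits.Ventures.PercRepro2.PMK5Locus
import Summits.Ventures.PercRepro2.PMK5LocusSS

/-!
# THE OPEN HALF OF THE LEAF ROW ON `K₅`: THE KERNEL CERTIFICATE OF p5's `groupL = crossA + crossB` AND THE
POSITIVE SIDE OF ITS EQUALITY LOCUS (blind cell PercRepro2, mine-2 g56; `conjectures/MINE-2.md` M2-126)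

`K₅` on the marks `o = 0, a₁ = 1, a₂ = 2, u = 3, b = 4` (the numbering of `PMK5Kernel.lean`), `Q = {a₁ ↮ a₂}`,
`L_x = {x ∈ C(a₁)}`, `H_x = {x ∈ C(a₂)}`, `oU = L_o ∪ H_o`.  The «G2 grouping» of the `a₃`-leaf middle
coefficient `R½ = halfL + halfH` (p5 g25, `LeafHalfCross.lean`: `halfL = (P(Q) − m_u)·anticov(oH, bL) + groupL`,
`groupL = crossA + crossB`, `crossB ≥ 0` a theorem, `crossA` of either sign) is, cleared by `P(Q)³`,

  `groupL = P(Q)²·P(Q, bL, uH, oU) − P(Q)·P(Q, bL)·P(Q, uH, oU) + P(Q, oU)·[P(Q, bL)·P(Q, uH) − P(Q)·P(Q, bL, uH)]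
           + P(Q)·[P(Q, bL)·P(Q, oH) − P(Q)·P(Q, bL, oH)]`

(three products minus three products of the tables `tQ, tQBL, tQHu, tQHo, tQoU, tQBLHu, tQBLHo, tQHuoU, tQBLHuoU` of
`PMK5Kernel.lean`).  **`certGL`** (one `decide +kernel`): every degree-3 tensor-Bernstein coefficient of `groupL` on `K₅`
is `≥ 0` (`24,637` positive classes of `4^10`, `0` negative — the census of M2-126), hence **`groupL_K5`**: `groupL ≥ 0`
for EVERY weight vector on `K₅` — the open half of the leaf row holds on every graph on the five marks (the K₅ case of
the candidate (LEAF-½)/G2; strictly stronger than `PMK5Theorem.halfL_K5`).  **The equality locus** (census, two codes):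
`groupL ≡ 0` on the face of an edge set `S` for `548` of the `1,024` edge sets, EXACTLY `RuleB ∪ RuleSS` (`RuleG2`):
¬[o ~ b avoiding {a₁, a₂}] ∨ ¬[o ~ a₁ avoiding a₂] ∨ (¬[o ~ a₂ avoiding a₁] ∧ ¬[u ~ a₂ avoiding a₁]) ∨ (¬[o ~ a₁] ∧ ¬[o ~ a₂]);
`21` minimal nonzero supports (3–4 edges), each with a witness profile of class sum `1` (`digGL`), the covering `coverGL2`,
and **`groupL_K5_pos_of_face`**: `groupL > 0` at every weight vector interior on a non-`RuleG2` edge set.  The zero side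
and the «iff»s are in `PMK5LocusZeroGroupL.lean`.  Standard axioms.
-/

namespace Summit.Ventures.PercRepro2

open Hub CovForm

namespace K5

namespace PM

/-! ## The Kronecker numbers and the certificate -/

/-- The positive part of `groupL`: `P·P·P(bL uH oU) + P(oU)·P(bL)·P(uH) + P·P(bL)·P(oH)`. -/
def kPosGL : ℕ := kron tQ * kron tQ * kron tQBLHuoU + kron tQoU * kron tQBL * kron tQHu +
  kron tQ * kron tQBL * kron tQHo

/-- The negative part of `groupL`: `P·P(bL)·P(uH oU) + P(oU)·P·P(bL uH) + P·P·P(bL oH)`. -/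
def kNegGL : ℕ := kron tQ * kron tQBL * kron tQHuoU + kron tQoU * kron tQ * kron tQBLHu +
  kron tQ * kron tQ * kron tQBLHo

set_option maxRecDepth 100000 in
set_option maxHeartbeats 0 in
/-- **The `K₅` certificate of the open half**: `kPosGL ≥ kNegGL` digitwise. -/
theorem certGL : kNegGL ≤ kPosGL ∧ Nat.land (kPosGL - kNegGL) mask = 0 ∧ Nat.land kNegGL mask = 0 := by
  decide +kernel

/-- The positive triple counts of `groupL`. -/
def cntPosGL (k : Fin 10 → Fin 4) : ℕ :=
  cnt3 tQ tQ tQBLHuoU k + cnt3 tQoU tQBL tQHu k + cnt3 tQ tQBL tQHo k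

/-- The negative triple counts of `groupL`. -/
def cntNegGL (k : Fin 10 → Fin 4) : ℕ :=
  cnt3 tQ tQBL tQHuoU k + cnt3 tQoU tQ tQBLHu k + cnt3 tQ tQ tQBLHo k

set_option maxRecDepth 100000 in
/-- Three Bernstein encodings add termwise. -/
lemma sum3 (A B C : (Fin 10 → Fin 4) → ℕ) :
    (∑ k, A k * KB ^ idx4 k) + (∑ k, B k * KB ^ idx4 k) + (∑ k, C k * KB ^ idx4 k) =
      ∑ k, (A k + B k + C k) * KB ^ idx4 k := by
  rw [← Finset.sum_add_distrib, ← Finset.sum_add_distrib]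
  exact Finset.sum_congr rfl (fun k _ => by rw [add_mul, add_mul])

/-- The first positive product carries its counts. -/
lemma prodP1_eq : kron tQ * kron tQ * kron tQBLHuoU = ∑ k, cnt3 tQ tQ tQBLHuoU k * KB ^ idx4 k := by
  rw [kron_eq_kronSum tQ, kron_eq_kronSum tQBLHuoU, kronSum_mul_mul]
/-- The second positive product carries its counts. -/
lemma prodP2_eq : kron tQoU * kron tQBL * kron tQHu = ∑ k, cnt3 tQoU tQBL tQHu k * KB ^ idx4 k := by
  rw [kron_eq_kronSum tQoU, kron_eq_kronSum tQBL, kron_eq_kronSum tQHu, kronSum_mul_mul]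
/-- The third positive product carries its counts. -/
lemma prodP3_eq : kron tQ * kron tQBL * kron tQHo = ∑ k, cnt3 tQ tQBL tQHo k * KB ^ idx4 k := by
  rw [kron_eq_kronSum tQ, kron_eq_kronSum tQBL, kron_eq_kronSum tQHo, kronSum_mul_mul]
/-- The first negative product carries its counts. -/
lemma prodN1_eq : kron tQ * kron tQBL * kron tQHuoU = ∑ k, cnt3 tQ tQBL tQHuoU k * KB ^ idx4 k := by
  rw [kron_eq_kronSum tQ, kron_eq_kronSum tQBL, kron_eq_kronSum tQHuoU, kronSum_mul_mul]
/-- The second negative product carries its counts. -/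
lemma prodN2_eq : kron tQoU * kron tQ * kron tQBLHu = ∑ k, cnt3 tQoU tQ tQBLHu k * KB ^ idx4 k := by
  rw [kron_eq_kronSum tQoU, kron_eq_kronSum tQ, kron_eq_kronSum tQBLHu, kronSum_mul_mul]
/-- The third negative product carries its counts. -/
lemma prodN3_eq : kron tQ * kron tQ * kron tQBLHo = ∑ k, cnt3 tQ tQ tQBLHo k * KB ^ idx4 k := by
  rw [kron_eq_kronSum tQ, kron_eq_kronSum tQBLHo, kronSum_mul_mul]

/-- `kPosGL` carries the positive counts. -/
lemma kPosGL_eq : kPosGL = ∑ k, cntPosGL k * KB ^ idx4 k :=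
  ((congrArg₂ (· + ·) (congrArg₂ (· + ·) prodP1_eq prodP2_eq) prodP3_eq).trans
    (sum3 (cnt3 tQ tQ tQBLHuoU) (cnt3 tQoU tQBL tQHu) (cnt3 tQ tQBL tQHo)))

/-- `kNegGL` carries the negative counts. -/
lemma kNegGL_eq : kNegGL = ∑ k, cntNegGL k * KB ^ idx4 k :=
  ((congrArg₂ (· + ·) (congrArg₂ (· + ·) prodN1_eq prodN2_eq) prodN3_eq).trans
    (sum3 (cnt3 tQ tQBL tQHuoU) (cnt3 tQoU tQ tQBLHu) (cnt3 tQ tQ tQBLHo)))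

/-- The counts are bounded by `3 · 3^10 < 2^19`. -/
lemma cntPosGL_lt (k : Fin 10 → Fin 4) : cntPosGL k < 2 ^ 19 := by
  unfold cntPosGL
  have h1 := cnt3_le tQ tQ tQBLHuoU k
  have h2 := cnt3_le tQoU tQBL tQHu k
  have h3 := cnt3_le tQ tQBL tQHo k
  omega

/-- The counts are bounded by `3 · 3^10 < 2^19`. -/
lemma cntNegGL_lt (k : Fin 10 → Fin 4) : cntNegGL k < 2 ^ 19 := by
  unfold cntNegGL
  have h1 := cnt3_le tQ tQBL tQHuoU k
  have h2 := cnt3_le tQoU tQ tQBLHu k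
  have h3 := cnt3_le tQ tQ tQBLHo k
  omega

/-- **Every Bernstein coefficient of `groupL` on `K₅` is `≥ 0`** (from `certGL`). -/
theorem cntNegGL_le_cntPosGL (k : Fin 10 → Fin 4) : cntNegGL k ≤ cntPosGL k :=
  le_of_kron_le cntPosGL cntNegGL cntPosGL_lt cntNegGL_lt kPosGL_eq kNegGL_eq certGL.1 certGL.2.1 k

section Bernstein

variable {R : Type*} [Field R] [LinearOrder R] [IsStrictOrderedRing R]

omit [LinearOrder R] [IsStrictOrderedRing R] in
/-- **The cleared `groupL` on `K₅` in the degree-3 Bernstein basis**: `Σ_k bern p k · (cntPosGL k − cntNegGL k)`. -/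
theorem groupL_eq_bern (p : Fin 10 → R) :
    prob p (connEvent ends5 1 2)ᶜ *
          (prob p (connEvent ends5 1 2)ᶜ *
              prob p (connEvent ends5 1 4 ∩ connEvent ends5 2 3 ∩
                (connEvent ends5 1 0 ∪ connEvent ends5 2 0) ∩ (connEvent ends5 1 2)ᶜ) -
            prob p (connEvent ends5 1 4 ∩ (connEvent ends5 1 2)ᶜ) *
              prob p (connEvent ends5 2 3 ∩ (connEvent ends5 1 0 ∪ connEvent ends5 2 0) ∩
                (connEvent ends5 1 2)ᶜ)) +
        prob p ((connEvent ends5 1 0 ∪ connEvent ends5 2 0) ∩ (connEvent ends5 1 2)ᶜ) *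
          (prob p (connEvent ends5 1 4 ∩ (connEvent ends5 1 2)ᶜ) *
              prob p (connEvent ends5 2 3 ∩ (connEvent ends5 1 2)ᶜ) -
            prob p (connEvent ends5 1 2)ᶜ *
              prob p (connEvent ends5 1 4 ∩ connEvent ends5 2 3 ∩ (connEvent ends5 1 2)ᶜ)) +
        prob p (connEvent ends5 1 2)ᶜ *
          (prob p (connEvent ends5 1 4 ∩ (connEvent ends5 1 2)ᶜ) *
              prob p (connEvent ends5 2 0 ∩ (connEvent ends5 1 2)ᶜ) -
            prob p (connEvent ends5 1 2)ᶜ *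
              prob p (connEvent ends5 1 4 ∩ connEvent ends5 2 0 ∩ (connEvent ends5 1 2)ᶜ)) =
      ∑ k, bern p k * ((cntPosGL k : ℕ) - (cntNegGL k : ℕ) : R) := by
  rw [prob_eq_bform p _ _ tQ_iff_compl, prob_eq_bform p _ _ tQBLHuoU_iff, prob_eq_bform p _ _ tQBL_iff',
    prob_eq_bform p _ _ tQHuoU_iff, prob_eq_bform p _ _ tQoU_iff, prob_eq_bform p _ _ tQBLHu_iff,
    prob_eq_bform p _ _ tQHu_iff, prob_eq_bform p _ _ tQBLHo_iff, prob_eq_bform p _ _ tQHo_iff]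
  have e : ∀ a b c d e f g h i : R,
      a * (a * b - c * d) + e * (c * g - a * f) + a * (c * i - a * h) =
        a * a * b + e * c * g + a * c * i - a * c * d - e * a * f - a * a * h := by intros; ring
  rw [e, bform_mul_mul, bform_mul_mul, bform_mul_mul, bform_mul_mul, bform_mul_mul, bform_mul_mul,
    ← Finset.sum_add_distrib, ← Finset.sum_add_distrib, ← Finset.sum_sub_distrib, ← Finset.sum_sub_distrib,
    ← Finset.sum_sub_distrib]
  refine Finset.sum_congr rfl fun k _ => ?_
  rw [coef3_eq_cnt3, coef3_eq_cnt3, coef3_eq_cnt3, coef3_eq_cnt3, coef3_eq_cnt3, coef3_eq_cnt3]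
  unfold cntPosGL cntNegGL
  push_cast
  ring

/-- **THE OPEN HALF OF THE LEAF ROW ON `K₅`, EVERY WEIGHT VECTOR**: `groupL ≥ 0` (cleared by `P(Q)³`) for every
admissible `p ∈ [0,1]^10`, marks `(o, a₁, a₂, u, b) = (0, 1, 2, 3, 4)` — hence on every simple graph on five vertices
carrying the five marks (the missing edges at weight `0`). -/
theorem groupL_K5 (p : Fin 10 → R) (hp : IsProbVec p) :
    0 ≤ prob p (connEvent ends5 1 2)ᶜ *
          (prob p (connEvent ends5 1 2)ᶜ *
              prob p (connEvent ends5 1 4 ∩ connEvent ends5 2 3 ∩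
                (connEvent ends5 1 0 ∪ connEvent ends5 2 0) ∩ (connEvent ends5 1 2)ᶜ) -
            prob p (connEvent ends5 1 4 ∩ (connEvent ends5 1 2)ᶜ) *
              prob p (connEvent ends5 2 3 ∩ (connEvent ends5 1 0 ∪ connEvent ends5 2 0) ∩
                (connEvent ends5 1 2)ᶜ)) +
        prob p ((connEvent ends5 1 0 ∪ connEvent ends5 2 0) ∩ (connEvent ends5 1 2)ᶜ) *
          (prob p (connEvent ends5 1 4 ∩ (connEvent ends5 1 2)ᶜ) *
              prob p (connEvent ends5 2 3 ∩ (connEvent ends5 1 2)ᶜ) -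
            prob p (connEvent ends5 1 2)ᶜ *
              prob p (connEvent ends5 1 4 ∩ connEvent ends5 2 3 ∩ (connEvent ends5 1 2)ᶜ)) +
        prob p (connEvent ends5 1 2)ᶜ *
          (prob p (connEvent ends5 1 4 ∩ (connEvent ends5 1 2)ᶜ) *
              prob p (connEvent ends5 2 0 ∩ (connEvent ends5 1 2)ᶜ) -
            prob p (connEvent ends5 1 2)ᶜ *
              prob p (connEvent ends5 1 4 ∩ connEvent ends5 2 0 ∩ (connEvent ends5 1 2)ᶜ)) := by
  rw [groupL_eq_bern]
  refine Finset.sum_nonneg fun k _ => mul_nonneg (bern_nonneg (fun i => ⟨hp.nonneg i, hp.le_one i⟩) k) ?_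
  rw [sub_nonneg]
  exact_mod_cast cntNegGL_le_cntPosGL k

end Bernstein

/-! ## The witness digits (kernel) -/

set_option maxRecDepth 100000 in
/-- The class sums of `groupL` at the 21 witness profiles, read off the Kronecker digits of `kPosGL − kNegGL`. -/
theorem digGL : (kPosGL - kNegGL) / KB ^ 69 % KB = 1 ∧
    (kPosGL - kNegGL) / KB ^ 1108 % KB = 1 ∧
    (kPosGL - kNegGL) / KB ^ 4164 % KB = 1 ∧
    (kPosGL - kNegGL) / KB ^ 16449 % KB = 1 ∧
    (kPosGL - kNegGL) / KB ^ 18528 % KB = 1 ∧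
    (kPosGL - kNegGL) / KB ^ 20544 % KB = 1 ∧
    (kPosGL - kNegGL) / KB ^ 65665 % KB = 1 ∧
    (kPosGL - kNegGL) / KB ^ 66704 % KB = 1 ∧
    (kPosGL - kNegGL) / KB ^ 69696 % KB = 1 ∧
    (kPosGL - kNegGL) / KB ^ 262165 % KB = 1 ∧
    (kPosGL - kNegGL) / KB ^ 263208 % KB = 1 ∧
    (kPosGL - kNegGL) / KB ^ 263236 % KB = 1 ∧
    (kPosGL - kNegGL) / KB ^ 266280 % KB = 1 ∧
    (kPosGL - kNegGL) / KB ^ 278562 % KB = 1 ∧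
    (kPosGL - kNegGL) / KB ^ 280592 % KB = 1 ∧
    (kPosGL - kNegGL) / KB ^ 542784 % KB = 1 ∧
    (kPosGL - kNegGL) / KB ^ 299024 % KB = 1 ∧
    (kPosGL - kNegGL) / KB ^ 589858 % KB = 1 ∧
    (kPosGL - kNegGL) / KB ^ 591888 % KB = 1 ∧
    (kPosGL - kNegGL) / KB ^ 328768 % KB = 1 ∧
    (kPosGL - kNegGL) / KB ^ 598032 % KB = 1 := by
  decide +kernel

/-- Witness 0: the profile of index `69` (support `{oa1 oa2 ob}`, mask `11`) has the `groupL`-class sum `1`. -/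
theorem wGL0 : cntNegGL (decode4 69) < cntPosGL (decode4 69) :=
  digit_lt_of_kron cntPosGL cntNegGL cntPosGL_lt cntNegGL_le_cntPosGL kPosGL_eq kNegGL_eq 69
    (by norm_num) digGL.1 (by norm_num)
/-- Witness 1: the profile of index `1108` (support `{oa2 ou ob a1u}`, mask `46`) has the `groupL`-class sum `1`. -/
theorem wGL1 : cntNegGL (decode4 1108) < cntPosGL (decode4 1108) :=
  digit_lt_of_kron cntPosGL cntNegGL cntPosGL_lt cntNegGL_le_cntPosGL kPosGL_eq kNegGL_eq 1108
    (by norm_num) digGL.2.1 (by norm_num)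
/-- Witness 2: the profile of index `4164` (support `{oa2 ob a1b}`, mask `74`) has the `groupL`-class sum `1`. -/
theorem wGL2 : cntNegGL (decode4 4164) < cntPosGL (decode4 4164) :=
  digit_lt_of_kron cntPosGL cntNegGL cntPosGL_lt cntNegGL_le_cntPosGL kPosGL_eq kNegGL_eq 4164
    (by norm_num) digGL.2.2.1 (by norm_num)
/-- Witness 3: the profile of index `16449` (support `{oa1 ob a2u}`, mask `137`) has the `groupL`-class sum `1`. -/
theorem wGL3 : cntNegGL (decode4 16449) < cntPosGL (decode4 16449) :=
  digit_lt_of_kron cntPosGL cntNegGL cntPosGL_lt cntNegGL_le_cntPosGL kPosGL_eq kNegGL_eq 16449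
    (by norm_num) digGL.2.2.2.1 (by norm_num)
/-- Witness 4: the profile of index `18528` (support `{ou ob a1u a2u}`, mask `172`) has the `groupL`-class sum `1`. -/
theorem wGL4 : cntNegGL (decode4 18528) < cntPosGL (decode4 18528) :=
  digit_lt_of_kron cntPosGL cntNegGL cntPosGL_lt cntNegGL_le_cntPosGL kPosGL_eq kNegGL_eq 18528
    (by norm_num) digGL.2.2.2.2.1 (by norm_num)
/-- Witness 5: the profile of index `20544` (support `{ob a1b a2u}`, mask `200`) has the `groupL`-class sum `1`. -/
theorem wGL5 : cntNegGL (decode4 20544) < cntPosGL (decode4 20544) :=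
  digit_lt_of_kron cntPosGL cntNegGL cntPosGL_lt cntNegGL_le_cntPosGL kPosGL_eq kNegGL_eq 20544
    (by norm_num) digGL.2.2.2.2.2.1 (by norm_num)
/-- Witness 6: the profile of index `65665` (support `{oa1 ob a2b}`, mask `265`) has the `groupL`-class sum `1`. -/
theorem wGL6 : cntNegGL (decode4 65665) < cntPosGL (decode4 65665) :=
  digit_lt_of_kron cntPosGL cntNegGL cntPosGL_lt cntNegGL_le_cntPosGL kPosGL_eq kNegGL_eq 65665
    (by norm_num) digGL.2.2.2.2.2.2.1 (by norm_num)
/-- Witness 7: the profile of index `66704` (support `{ou ob a1u a2b}`, mask `300`) has the `groupL`-class sum `1`. -/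
theorem wGL7 : cntNegGL (decode4 66704) < cntPosGL (decode4 66704) :=
  digit_lt_of_kron cntPosGL cntNegGL cntPosGL_lt cntNegGL_le_cntPosGL kPosGL_eq kNegGL_eq 66704
    (by norm_num) digGL.2.2.2.2.2.2.2.1 (by norm_num)
/-- Witness 8: the profile of index `69696` (support `{ob a1b a2b}`, mask `328`) has the `groupL`-class sum `1`. -/
theorem wGL8 : cntNegGL (decode4 69696) < cntPosGL (decode4 69696) :=
  digit_lt_of_kron cntPosGL cntNegGL cntPosGL_lt cntNegGL_le_cntPosGL kPosGL_eq kNegGL_eq 69696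
    (by norm_num) digGL.2.2.2.2.2.2.2.2.1 (by norm_num)
/-- Witness 9: the profile of index `262165` (support `{oa1 oa2 ou ub}`, mask `519`) has the `groupL`-class sum `1`. -/
theorem wGL9 : cntNegGL (decode4 262165) < cntPosGL (decode4 262165) :=
  digit_lt_of_kron cntPosGL cntNegGL cntPosGL_lt cntNegGL_le_cntPosGL kPosGL_eq kNegGL_eq 262165
    (by norm_num) digGL.2.2.2.2.2.2.2.2.2.1 (by norm_num)
/-- Witness 10: the profile of index `263208` (support `{oa2 ou a1u ub}`, mask `550`) has the `groupL`-class sum `1`. -/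
theorem wGL10 : cntNegGL (decode4 263208) < cntPosGL (decode4 263208) :=
  digit_lt_of_kron cntPosGL cntNegGL cntPosGL_lt cntNegGL_le_cntPosGL kPosGL_eq kNegGL_eq 263208
    (by norm_num) digGL.2.2.2.2.2.2.2.2.2.2.1 (by norm_num)
/-- Witness 11: the profile of index `263236` (support `{oa2 ob a1u ub}`, mask `554`) has the `groupL`-class sum `1`. -/
theorem wGL11 : cntNegGL (decode4 263236) < cntPosGL (decode4 263236) :=
  digit_lt_of_kron cntPosGL cntNegGL cntPosGL_lt cntNegGL_le_cntPosGL kPosGL_eq kNegGL_eq 263236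
    (by norm_num) digGL.2.2.2.2.2.2.2.2.2.2.2.1 (by norm_num)
/-- Witness 12: the profile of index `266280` (support `{oa2 ou a1b ub}`, mask `582`) has the `groupL`-class sum `1`. -/
theorem wGL12 : cntNegGL (decode4 266280) < cntPosGL (decode4 266280) :=
  digit_lt_of_kron cntPosGL cntNegGL cntPosGL_lt cntNegGL_le_cntPosGL kPosGL_eq kNegGL_eq 266280
    (by norm_num) digGL.2.2.2.2.2.2.2.2.2.2.2.2.1 (by norm_num)
/-- Witness 13: the profile of index `278562` (support `{oa1 ou a2u ub}`, mask `645`) has the `groupL`-class sum `1`. -/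
theorem wGL13 : cntNegGL (decode4 278562) < cntPosGL (decode4 278562) :=
  digit_lt_of_kron cntPosGL cntNegGL cntPosGL_lt cntNegGL_le_cntPosGL kPosGL_eq kNegGL_eq 278562
    (by norm_num) digGL.2.2.2.2.2.2.2.2.2.2.2.2.2.1 (by norm_num)
/-- Witness 14: the profile of index `280592` (support `{ou a1u a2u ub}`, mask `676`) has the `groupL`-class sum `1`. -/
theorem wGL14 : cntNegGL (decode4 280592) < cntPosGL (decode4 280592) :=
  digit_lt_of_kron cntPosGL cntNegGL cntPosGL_lt cntNegGL_le_cntPosGL kPosGL_eq kNegGL_eq 280592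
    (by norm_num) digGL.2.2.2.2.2.2.2.2.2.2.2.2.2.2.1 (by norm_num)
/-- Witness 15: the profile of index `542784` (support `{ob a1u a2u ub}`, mask `680`) has the `groupL`-class sum `1`. -/
theorem wGL15 : cntNegGL (decode4 542784) < cntPosGL (decode4 542784) :=
  digit_lt_of_kron cntPosGL cntNegGL cntPosGL_lt cntNegGL_le_cntPosGL kPosGL_eq kNegGL_eq 542784
    (by norm_num) digGL.2.2.2.2.2.2.2.2.2.2.2.2.2.2.2.1 (by norm_num)
/-- Witness 16: the profile of index `299024` (support `{ou a1b a2u ub}`, mask `708`) has the `groupL`-class sum `1`. -/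
theorem wGL16 : cntNegGL (decode4 299024) < cntPosGL (decode4 299024) :=
  digit_lt_of_kron cntPosGL cntNegGL cntPosGL_lt cntNegGL_le_cntPosGL kPosGL_eq kNegGL_eq 299024
    (by norm_num) digGL.2.2.2.2.2.2.2.2.2.2.2.2.2.2.2.2.1 (by norm_num)
/-- Witness 17: the profile of index `589858` (support `{oa1 ou a2b ub}`, mask `773`) has the `groupL`-class sum `1`. -/
theorem wGL17 : cntNegGL (decode4 589858) < cntPosGL (decode4 589858) :=
  digit_lt_of_kron cntPosGL cntNegGL cntPosGL_lt cntNegGL_le_cntPosGL kPosGL_eq kNegGL_eq 589858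
    (by norm_num) digGL.2.2.2.2.2.2.2.2.2.2.2.2.2.2.2.2.2.1 (by norm_num)
/-- Witness 18: the profile of index `591888` (support `{ou a1u a2b ub}`, mask `804`) has the `groupL`-class sum `1`. -/
theorem wGL18 : cntNegGL (decode4 591888) < cntPosGL (decode4 591888) :=
  digit_lt_of_kron cntPosGL cntNegGL cntPosGL_lt cntNegGL_le_cntPosGL kPosGL_eq kNegGL_eq 591888
    (by norm_num) digGL.2.2.2.2.2.2.2.2.2.2.2.2.2.2.2.2.2.2.1 (by norm_num)
/-- Witness 19: the profile of index `328768` (support `{ob a1u a2b ub}`, mask `808`) has the `groupL`-class sum `1`. -/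
theorem wGL19 : cntNegGL (decode4 328768) < cntPosGL (decode4 328768) :=
  digit_lt_of_kron cntPosGL cntNegGL cntPosGL_lt cntNegGL_le_cntPosGL kPosGL_eq kNegGL_eq 328768
    (by norm_num) digGL.2.2.2.2.2.2.2.2.2.2.2.2.2.2.2.2.2.2.2.1 (by norm_num)
/-- Witness 20: the profile of index `598032` (support `{ou a1b a2b ub}`, mask `836`) has the `groupL`-class sum `1`. -/
theorem wGL20 : cntNegGL (decode4 598032) < cntPosGL (decode4 598032) :=
  digit_lt_of_kron cntPosGL cntNegGL cntPosGL_lt cntNegGL_le_cntPosGL kPosGL_eq kNegGL_eq 598032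
    (by norm_num) digGL.2.2.2.2.2.2.2.2.2.2.2.2.2.2.2.2.2.2.2.2 (by norm_num)

/-- The Kronecker indices of the 21 witness profiles (one per minimal nonzero support). -/
def NGL : Fin 21 → ℕ := ![69, 1108, 4164, 16449, 18528, 20544, 65665, 66704, 69696, 262165, 263208, 263236, 266280, 278562, 280592, 542784, 299024, 589858, 591888, 328768, 598032]

/-- The supports of the 21 witness profiles, as edge bitmasks. -/
def WGL : Fin 21 → ℕ := ![11, 46, 74, 137, 172, 200, 265, 300, 328, 519, 550, 554, 582, 645, 676, 680, 708, 773, 804, 808, 836]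

/-- Every witness coefficient of `groupL` is strictly positive. -/
theorem witnessGL_lt : ∀ i : Fin 21, cntNegGL (decode4 (NGL i)) < cntPosGL (decode4 (NGL i)) := by
  intro i
  fin_cases i
  exacts [wGL0, wGL1, wGL2, wGL3, wGL4, wGL5, wGL6, wGL7, wGL8, wGL9, wGL10, wGL11, wGL12, wGL13, wGL14, wGL15, wGL16, wGL17, wGL18, wGL19, wGL20]

set_option maxRecDepth 100000 in
/-- The support of the `i`-th witness profile is the mask `WGL i`. -/
theorem supp_WGL : ∀ i : Fin 21, ∀ e : Fin 10, decode4 (NGL i) e ≠ 0 → (WGL i).testBit e = true := by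
  decide +kernel

/-- **The `groupL`-degenerate edge sets** — `RuleB ∪ RuleSS`, the exact zero set of the open half on `K₅`. -/
def RuleG2 (m : ℕ) : Bool := RuleB m || RuleSS m

set_option maxRecDepth 100000 in
/-- **The covering**: every non-`RuleG2` edge set contains the support of a witness profile. -/
theorem coverGL2 : ∀ m : Fin 1024, RuleG2 m = false →
    ∃ i : Fin 21, ∀ e : Fin 10, (WGL i).testBit e = true → (m : ℕ).testBit e = true := by
  decide +kernel

section Face

variable {R : Type*} [Field R] [LinearOrder R] [IsStrictOrderedRing R]

/-- **THE EQUALITY LOCUS OF THE OPEN HALF — THE POSITIVE SIDE (Bernstein form).** -/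
theorem groupL_K5_pos_of_face (m : ℕ) (hm : m < 1024) (hr : RuleG2 m = false) (q : Fin 10 → R)
    (hq₁ : ∀ e : Fin 10, m.testBit e = true → 0 < q e ∧ q e < 1)
    (hq₀ : ∀ e : Fin 10, m.testBit e = false → q e = 0) :
    0 < ∑ k, bern q k * ((cntPosGL k : ℕ) - (cntNegGL k : ℕ) : R) := by
  obtain ⟨i, hi⟩ := coverGL2 ⟨m, hm⟩ hr
  have hk := witnessGL_lt i
  have hs : ∀ e : Fin 10, decode4 (NGL i) e ≠ 0 → m.testBit e = true := fun e he => hi e (supp_WGL i e he)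
  have hb : 0 < bern q (decode4 (NGL i)) := bern_pos_of_face hq₁ hq₀ _ hs
  have h01 : ∀ e, 0 ≤ q e ∧ q e ≤ 1 := fun e => by
    by_cases he : m.testBit e = true
    · exact ⟨(hq₁ e he).1.le, (hq₁ e he).2.le⟩
    · rw [hq₀ e (by simpa using he)]
      exact ⟨le_rfl, zero_le_one⟩
  calc (0 : R) < bern q (decode4 (NGL i)) * ((cntPosGL (decode4 (NGL i)) : ℕ) - (cntNegGL (decode4 (NGL i)) : ℕ) : R) := by
        apply mul_pos hb
        rw [sub_pos]
        exact_mod_cast hk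
    _ ≤ ∑ k, bern q k * ((cntPosGL k : ℕ) - (cntNegGL k : ℕ) : R) :=
        Finset.single_le_sum (f := fun k => bern q k * ((cntPosGL k : ℕ) - (cntNegGL k : ℕ) : R))
          (fun k _ => mul_nonneg (bern_nonneg h01 k) (by rw [sub_nonneg]; exact_mod_cast cntNegGL_le_cntPosGL k))
          (Finset.mem_univ _)

end Face

end PM

end K5

end Summit.Ventures.PercRepro2
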